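import Mathlib
import HarnessLib
import Summits.HubbardSuperconductivity.HubbardSuperconductivity.Theorems.KLProgrammeKLRegimeSplitTwoLegCoreTZeroSep
import Summits.HubbardSuperconductivity.HubbardSuperconductivity.Theorems.KLProgrammeKLRegimeSplitTwoLegIncrementSizes

/-!
# Route `KLProgramme` — gen-5 ENGINE child 19918, stub `stub_twoLeg_step`, part A: tier-1 sizes of `ℓ_{n+1}` from momentum-side sizes of
# ORDER ≤ 2 ONLY; the increment's off-diagonal position moments; the K-separated gradient of `S_n`

Cell `gate-hubbard-kl`, seat p1b (g7).  The tree's tier-1 closers for `ℓ_{n+1}` (`twoLegPieceV13_tier1_size_le`, k3c3-p3;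
`twoLegCoreT_succ_of_position_exports_explicit/_stub5`, p1b) take the coefficient / position moments of the increment for ALL `k ≤ 4` and with the
weight `(1 + |Δx̃|)ᵏ`.  Two defects for the fit, both order-bookkeeping, not text: (i) orders 3–4 of the increment's position moments are not
frame-uniform (k3c3-p2 g4 MS-CONSUMER §2: every line carries `e_K`), yet tier 1 never reads them; (ii) the weight charges the spatially LOCAL
`O(U·Λ²_{n+1})` tadpole of the increment to the derivative orders `j = 1, 2`, whose budgets `twoLegBar … j (n+1)` are `O(U²)` — at the shallow
scales `4^{−n} ≳ U` the fit cannot hold; and the (E3e) gradient of `S_{n+1}` read from the FULL first moment of `W^{(n+1)}` contains the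
counterterm vertex's coefficient moment (not controlled by `FrameOK`).  This file re-keys the step closer accordingly:

* **`twoLegPieceV13_tier1_size_le_sep`** — k3c3-p3's order-resolved tier-1 sizes of `ℓ_{n+1}` from MOMENTUM-SIDE sizes
  `Mₖ ≥ ‖Dᵏ evalM (symInterp L Δσ_{n+1})‖`, `k ≤ 2` only (orders 3–4 intrinsic);
* `klLocSelfEnergyRe_succ_sub_eq_locRe` — `Δσ_{n+1} = loc(𝒱^{(n+1)} − 𝒱^{(n)})`; `norm_fderiv_evalM_twoLegPoly_le_sep` — at every scale `n`,
  `‖∇ evalM S_n‖ ≤ m₁ + a₁ + ‖D¹ frameShift K‖` from the K-separated data (`…TwoLegCounterVertex`) and the aliasing size;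
* `increment_sep_moments_of_position` — the sizes `Mₖ` from the full zeroth / OFF-DIAGONAL first and second position moments of `𝒱^{(n+1)} − 𝒱^{(n)}`.
Part B (`…TwoLegCoreTSuccSep`) assembles `TwoLegCoreT … K (n+1)` from these.

Proofs only; nothing about the model is asserted.  References: BGM 2006 §2.4 (2.36), (2.40) [cite: BenfattoGiulianiMastropietro2006].
-/

noncomputable section

namespace Summit.HubbardSuperconductivity.HubbardSuperconductivity.Theorems.KLRegimeSplit

set_option linter.dupNamespace false -- summit = problem name (single-conjunct summit), D-0017

open Real Finset
open Literature.MathematicalPhysics.QuantumLattice Literature.MathematicalPhysics.QuantumLattice.BandSectorCounting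
open Literature.Probability.LatticeModels
open Summit.HubbardSuperconductivity.HubbardSuperconductivity.Theorems.DispersionFlow
open Summit.HubbardSuperconductivity.HubbardSuperconductivity.Theorems.PerturbedFermiCurve
open Summit.HubbardSuperconductivity.HubbardSuperconductivity.Theorems.KLProgrammeLegKernels
open Summit.HubbardSuperconductivity.HubbardSuperconductivity.Theorems.TwoLegFourier
open Summit.HubbardSuperconductivity.HubbardSuperconductivity.Theorems.EngineV8

variable {L M : ℕ} [NeZero L] [NeZero M]

/-! ## §1 Tier-1 sizes of `ℓ_{n+1}` from momentum-side sizes of order ≤ 2 -/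

/-- **(E3a) tier 1 of `ℓ_{n+1}`, ORDERS ≤ 2 ONLY**: k3c3-p3's `twoLegPieceV13_tier1_size_le` re-keyed on the momentum-side sizes
`Mₖ ≥ ‖Dᵏ evalM (symInterp L (σ_{n+1} − σ_n))‖` for `k ≤ 2` (orders 3, 4, needed only to run the composite tower, are intrinsic). -/
theorem twoLegPieceV13_tier1_size_le_sep {R : RenConsts} (hR : ∀ j, 0 ≤ R.Gfr j) {c : ℝ} (hc : 0 < c) (hcle : c ≤ klCurveC3 R)
    {U : ℝ} (hU : 0 < U) (hUle : U ≤ klCurveU0 R) {β : ℝ} (hβmin : klBetaMin ≤ β) (hβc : β ≤ Real.exp (c / U ^ 2))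
    {μ : ℝ} (hμ : μ ∈ klWindowC) {K : TrigPolyC4v} (hK : FrameOK R U (nScales β) μ K) (n : ℕ) {Mv : ℕ → ℝ}
    (hM : ∀ k ≤ 2, ∀ p : Momentum, ‖iteratedFDeriv ℝ k
      (evalM (symInterp L fun q => klLocSelfEnergyRe L M β U μ K (n + 1) q - klLocSelfEnergyRe L M β U μ K n q)) p‖ ≤ Mv k)
    {j : ℕ} (hj : j ≤ 2) {X : ℝ} (hX : ∀ l ≤ j, ∀ x : ℝ, ‖iteratedFDeriv ℝ l salmhoferCutoff x‖ ≤ X) (q : Momentum) :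
    ‖iteratedFDeriv ℝ j (onM (klTwoLegPieceFn L M β U μ K.eval (n + 1))) q‖ ≤
      (if j = 0 then Mv 0 else 0) +
        (j.factorial : ℝ) ^ 2 * (2 * j.factorial * X * 200 ^ j) *
          (if j = 0 then 2 * Mv 0 else (2 * π + 1) * (Mv 1 * klCurveD1) + (if j = 2 then Mv 2 * klCurveD1 ^ 2 + Mv 1 * klCurveD2 else 0)) *
          (4 + max 1 (((j - 1).factorial : ℝ) / (8 / 5))) ^ j := by
  have ha' : (-4 : ℝ) < -1.1 := by norm_num
  have hab : (-1.1 : ℝ) ≤ -0.1 := by norm_num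
  have hb : (-0.1 : ℝ) < 0 := by norm_num
  obtain ⟨hAf, hA20, hADt, -, ⟨hlo, hhi⟩, hA3f, hA4f⟩ := frame_sizes_of_frameOK_explicit hR hc hcle hU hUle hβmin hβc hμ hK
  set S := symInterp L (fun q => klLocSelfEnergyRe L M β U μ K (n + 1) q - klLocSelfEnergyRe L M β U μ K n q) with hS
  set F : Momentum → ℝ := evalM S with hF
  set δ : ℝ → ℝ := fun θ => klLocalPart L M β U μ K (n + 1) θ - klLocalPart L M β U μ K n θ with hδ
  have hδF : δ = F ∘ fun θ => (WithLp.toLp 2 (klFermiPoint μ K θ) : Momentum) := klLocalPart_sub_eq_evalM_comp β U μ K n (n + 1)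
  have hFc : ContDiff ℝ 4 F := contDiff_evalM S
  -- sizes: orders ≤ 2 from `hM`, orders 3, 4 intrinsic
  set Mf : ℕ → ℝ := fun k => if k ≤ 2 then Mv k else S.coeffNorm k with hMf
  have hMk : ∀ k ≤ 4, ∀ p : Momentum, ‖iteratedFDeriv ℝ k F p‖ ≤ Mf k := by
    intro k _ p
    by_cases hk2 : k ≤ 2
    · have h2 : Mf k = Mv k := by simp [hMf, hk2]
      rw [h2]; exact hM k hk2 p
    · have h2 : Mf k = S.coeffNorm k := by simp [hMf, hk2]
      rw [h2]; exact norm_iteratedFDeriv_evalM_le_coeffNorm S k p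
  have hM0 : Mf 0 = Mv 0 := by simp [hMf]
  have hM1 : Mf 1 = Mv 1 := by simp [hMf]
  have hM2 : Mf 2 = Mv 2 := by simp [hMf]
  have hval : ∀ θ, |δ θ| ≤ Mv 0 := fun θ => by
    rw [hδF, Function.comp_apply, ← Real.norm_eq_abs, ← norm_iteratedFDeriv_zero (𝕜 := ℝ), ← hM0]
    exact hMk 0 (by norm_num) _
  have hstruct := fun θ => abs_iteratedDeriv_comp_fermiPointLp_le_struct hR hc hcle hU hUle hβmin hβc hμ hK hA3f hA4f hFc θ
    (m := Mf) (fun k _ hk4 => hMk k hk4 _)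
  have hδc : ContDiff ℝ 4 δ := by
    rw [hδF]; exact hFc.comp (fermiPointLp_sizes_explicit hR hc hcle hU hUle hβmin hβc hμ hK hA3f hA4f 0).1
  have hdiff : Differentiable ℝ δ := hδc.differentiable (by norm_num)
  have hper : Function.Periodic δ (2 * π) := fun θ => by
    simp only [hδ, klLocalPart_periodic β U μ K (n + 1) θ, klLocalPart_periodic β U μ K n θ]
  have h1 : ∀ θ, |deriv δ θ| ≤ Mv 1 * klCurveD1 := fun θ => by
    rw [← iteratedDeriv_one, hδF, ← hM1]; exact (hstruct θ).1
  have h2 : ∀ θ, |iteratedDeriv 2 δ θ| ≤ Mv 2 * klCurveD1 ^ 2 + Mv 1 * klCurveD2 := fun θ => by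
    rw [hδF, ← hM1, ← hM2]; exact (hstruct θ).2.1
  have hmean : |klAngularMean δ| ≤ Mv 0 := abs_klAngularMean_le' hval
  have hosc : ∀ t, |δ t - klAngularMean δ| ≤ 2 * π * (Mv 1 * klCurveD1) := fun t =>
    abs_sub_klAngularMean_le_of_deriv hdiff hper h1 t
  have hB1 : 0 ≤ Mv 1 * klCurveD1 := (abs_nonneg _).trans (h1 0)
  have hB2 : 0 ≤ Mv 2 * klCurveD1 ^ 2 + Mv 1 * klCurveD2 := (abs_nonneg _).trans (h2 0)
  have hcd : ∀ i ≤ 2, ∀ t, 1 ≤ i → iteratedFDeriv ℝ i (fun t => δ t - klAngularMean δ) t = iteratedFDeriv ℝ i δ t := by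
    intro i hi t hi1
    rw [fun_iteratedFDeriv_sub_apply (hδc.contDiffAt.of_le (by exact_mod_cast hi.trans (by norm_num))) contDiffAt_const,
      iteratedFDeriv_const_of_ne (by omega), Pi.zero_apply, sub_zero]
  have hG0 : ∀ t, ‖iteratedFDeriv ℝ 0 (fun t => δ t - klAngularMean δ) t‖ ≤ 2 * Mv 0 := fun t => by
    rw [norm_iteratedFDeriv_zero, Real.norm_eq_abs]
    have := abs_sub (δ t) (klAngularMean δ); have := hval t; linarith
  have hG0' : ∀ t, ‖iteratedFDeriv ℝ 0 (fun t => δ t - klAngularMean δ) t‖ ≤ (2 * π + 1) * (Mv 1 * klCurveD1) := fun t => by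
    rw [norm_iteratedFDeriv_zero, Real.norm_eq_abs]; have := hosc t; nlinarith
  have hG1 : ∀ t, ‖iteratedFDeriv ℝ 1 (fun t => δ t - klAngularMean δ) t‖ ≤ (2 * π + 1) * (Mv 1 * klCurveD1) := fun t => by
    rw [hcd 1 (by norm_num) t le_rfl, norm_iteratedFDeriv_eq_norm_iteratedDeriv, iteratedDeriv_one, Real.norm_eq_abs]
    have := h1 t; nlinarith [Real.pi_pos]
  have hG2 : ∀ t, ‖iteratedFDeriv ℝ 2 (fun t => δ t - klAngularMean δ) t‖ ≤
      Mv 2 * klCurveD1 ^ 2 + Mv 1 * klCurveD2 := fun t => by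
    rw [hcd 2 le_rfl t (by norm_num), norm_iteratedFDeriv_eq_norm_iteratedDeriv, Real.norm_eq_abs]; exact h2 t
  have hνC : ∀ k : ℕ, ContDiff ℝ 4 (klLocalPart L M β U μ K k) := fun k =>
    contDiff_klLocalPart (bandBounds ha' hab hb) hAf hADt hlo hhi L M β U k
  have key : ∀ {G : ℝ}, (∀ i ≤ j, ∀ t : ℝ, ‖iteratedFDeriv ℝ i (fun t => δ t - klAngularMean δ) t‖ ≤ G) →
      ‖iteratedFDeriv ℝ j (onM (klTwoLegPieceFn L M β U μ K.eval (n + 1))) q‖ ≤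
        (if j = 0 then Mv 0 else 0) +
          (j.factorial : ℝ) ^ 2 * (2 * j.factorial * X * 200 ^ j) * G * (4 + max 1 (((j - 1).factorial : ℝ) / (8 / 5))) ^ j := by
    intro G hG
    have hmain := norm_iteratedFDeriv_onM_klTwoLegPieceFn_eval_succ_le (L := L) (M := M) K n (N := 4) (hνC (n + 1)) (hνC n)
      (j := j) (by exact_mod_cast hj.trans (by norm_num : 2 ≤ 4)) hμ hG hX q
    refine hmain.trans (add_le_add ?_ le_rfl)
    split_ifs
    · exact hmean
    · exact le_rfl
  rcases Nat.lt_or_ge j 1 with hj0 | hj1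
  · have hj0' : j = 0 := by omega
    subst hj0'
    simp only [if_true] at key ⊢
    exact key fun i hi t => by
      have hi0 : i = 0 := by omega
      subst hi0; exact hG0 t
  · have hjne : j ≠ 0 := by omega
    rcases Nat.lt_or_ge j 2 with hj1' | hj2
    · have hj1'' : j = 1 := by omega
      subst hj1''
      simp only [if_neg one_ne_zero, show (1 : ℕ) ≠ 2 by norm_num, if_false, add_zero] at key ⊢
      exact key fun i hi t => by
        rcases Nat.eq_zero_or_pos i with rfl | hipos
        · exact hG0' t
        · have hi1 : i = 1 := by omega
          subst hi1; exact hG1 t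
    · have hj2' : j = 2 := by omega
      subst hj2'
      simp only [show (2 : ℕ) ≠ 0 by norm_num, if_false, if_true] at key ⊢
      exact key fun i hi t => by
        rcases Nat.eq_zero_or_pos i with rfl | hipos
        · exact (hG0' t).trans (le_add_of_nonneg_right hB2)
        · rcases (show i = 1 ∨ i = 2 by omega) with rfl | rfl
          · exact (hG1 t).trans (le_add_of_nonneg_right hB2)
          · exact (hG2 t).trans (le_add_of_nonneg_left (by positivity))

/-! ## §2 The increment's data and the K-separated gradient at scale `n` -/

/-- `σ_{n+1} − σ_n = loc(𝒱^{(n+1)} − 𝒱^{(n)})` (the frame vertex cancels; `selfEnergy_sub`). -/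
theorem klLocSelfEnergyRe_succ_sub_eq_locRe (β U μ : ℝ) (K : TrigPolyC4v) (n : ℕ) (k : TorusSite 2 L) :
    klLocSelfEnergyRe L M β U μ K (n + 1) k - klLocSelfEnergyRe L M β U μ K n k =
      (∑ σ : Fin 2, ((selfEnergy L M β (klEffectiveAction L M β U μ K klE0 (n + 1) - klEffectiveAction L M β U μ K klE0 n)
          (omega0 M, k) σ).re +
        (selfEnergy L M β (klEffectiveAction L M β U μ K klE0 (n + 1) - klEffectiveAction L M β U μ K klE0 n)
          ((omega0 M).rev, k) σ).re)) / 4 := by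
  simp only [klLocSelfEnergyRe, klSelfEnergy, selfEnergy_sub, Complex.sub_re, Fin.sum_univ_two]
  ring

/-- **Momentum-side sizes of the increment from its position moments, off-diagonal at orders ≥ 1**: zeroth full moment `Mˢ₀` and
off-diagonal moments `Mˢ♯₁, Mˢ♯₂` of the unsectorised two-leg kernels of `𝒱^{(n+1)} − 𝒱^{(n)}` give
`‖Dᵏ evalM (symInterp L Δσ_{n+1})‖ ≤ 2·(Mˢ₀ | Mˢ♯ₖ)`, `k ≤ 2`. -/
theorem increment_sep_moments_of_position {β : ℝ} (hβ : 0 < β) (U μ : ℝ) (K : TrigPolyC4v) (n : ℕ) {Ms0 : ℝ} {Msh : ℕ → ℝ}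
    (hMs0 : ∀ (σ : Fin 2) (x₀ : SpaceTimeIdx L M), imagTimeWeight β M *
      ∑ x ∈ (univ : Finset (Fin 2 → SpaceTimeIdx L M)).filter (fun x => x 0 = x₀),
        (1 + ((((x 1).2 - (x 0).2) 0).valMinAbs.natAbs : ℝ) + ((((x 1).2 - (x 0).2) 1).valMinAbs.natAbs : ℝ)) ^ 0 *
          ‖sectorisedKernel L M β (trivialMultiplier L M)
              (klEffectiveAction L M β U μ K klE0 (n + 1) - klEffectiveAction L M β U μ K klE0 n) 2
              (![((0, σ), 0), ((0, σ), 1)] : Fin 2 → SectorLeg 1) x‖ ≤ Ms0)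
    (hMsh : ∀ k, 1 ≤ k → k ≤ 2 → ∀ (σ : Fin 2) (x₀ : SpaceTimeIdx L M), imagTimeWeight β M *
      ∑ x ∈ (univ : Finset (Fin 2 → SpaceTimeIdx L M)).filter (fun x => x 0 = x₀ ∧ (x 1).2 ≠ (x 0).2),
        (1 + ((((x 1).2 - (x 0).2) 0).valMinAbs.natAbs : ℝ) + ((((x 1).2 - (x 0).2) 1).valMinAbs.natAbs : ℝ)) ^ k *
          ‖sectorisedKernel L M β (trivialMultiplier L M)
              (klEffectiveAction L M β U μ K klE0 (n + 1) - klEffectiveAction L M β U μ K klE0 n) 2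
              (![((0, σ), 0), ((0, σ), 1)] : Fin 2 → SectorLeg 1) x‖ ≤ Msh k) :
    ∀ k ≤ 2, ∀ q : Momentum, ‖iteratedFDeriv ℝ k
      (evalM (symInterp L fun p => klLocSelfEnergyRe L M β U μ K (n + 1) p - klLocSelfEnergyRe L M β U μ K n p)) q‖ ≤
        2 * (if k = 0 then Ms0 else Msh k) := by
  intro k hk q
  have hfun : (fun p => klLocSelfEnergyRe L M β U μ K (n + 1) p - klLocSelfEnergyRe L M β U μ K n p) =
      fun p => (∑ σ : Fin 2, ((selfEnergy L M β (klEffectiveAction L M β U μ K klE0 (n + 1) - klEffectiveAction L M β U μ K klE0 n)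
          (omega0 M, p) σ).re +
        (selfEnergy L M β (klEffectiveAction L M β U μ K klE0 (n + 1) - klEffectiveAction L M β U μ K klE0 n)
          ((omega0 M).rev, p) σ).re)) / 4 := funext (klLocSelfEnergyRe_succ_sub_eq_locRe β U μ K n)
  rw [hfun]
  rcases Nat.eq_zero_or_pos k with rfl | hkpos
  · rw [if_pos rfl]
    exact norm_iteratedFDeriv_zero_evalM_symInterp_locRe_le hβ _ hMs0 q
  · rw [if_neg (by omega)]
    exact norm_iteratedFDeriv_evalM_symInterp_locRe_le_offDiag hβ _ hkpos (hMsh k hkpos hk) q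

/-- **K-separated gradient of `S_n` at any scale**: `‖∇ evalM (symInterp L σ_n)‖ ≤ m₁ + a₁ + ‖D¹ frameShift K‖` with `m₁ ≥ ‖D¹ evalM (symInterp L
(σ_n − K∘p))‖` (off-diagonal first moment of `𝒱^{(n)} − 𝒩_K`) and `a₁ ≥ ‖D¹(evalM (symInterp L (K∘p)) − evalM K)‖`. -/
theorem norm_fderiv_evalM_twoLegPoly_le_sep {β U μ : ℝ} {K : TrigPolyC4v} {n : ℕ} {m₁ a₁ : ℝ}
    (hm : ∀ p : Momentum, ‖iteratedFDeriv ℝ 1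
      (evalM (symInterp L (fun q => klLocSelfEnergyRe L M β U μ K n q - K.eval (latticeMomentum L q)))) p‖ ≤ m₁)
    (ha : ∀ p : Momentum, ‖iteratedFDeriv ℝ 1
      (fun p : Momentum => evalM (symInterp L (fun q => K.eval (latticeMomentum L q))) p - evalM K p) p‖ ≤ a₁) (q : Momentum) :
    ‖fderiv ℝ (evalM (symInterp L (klLocSelfEnergyRe L M β U μ K n))) q‖ ≤ m₁ + a₁ + ‖iteratedFDeriv ℝ 1 (frameShift K) q‖ := by
  set Fg : Momentum → ℝ := evalM (symInterp L (fun q => klLocSelfEnergyRe L M β U μ K n q - K.eval (latticeMomentum L q))) with hFg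
  set Fa : Momentum → ℝ := fun p => evalM (symInterp L (fun q => K.eval (latticeMomentum L q))) p - evalM K p with hFa
  have hFgc : ∀ {k : WithTop ℕ∞}, ContDiff ℝ k Fg := fun {k} => contDiff_evalM _
  have hFac : ∀ {k : WithTop ℕ∞}, ContDiff ℝ k Fa := fun {k} => (contDiff_evalM _).sub (contDiff_evalM K)
  have hKc : ∀ {k : WithTop ℕ∞}, ContDiff ℝ k (-frameShift K) := fun {k} => by
    have : frameShift K = -evalM K := by funext p; simp [frameShift, evalM]
    rw [this, neg_neg]; exact contDiff_evalM K
  have hsplit : evalM (symInterp L (klLocSelfEnergyRe L M β U μ K n)) = (Fg + Fa) + (-frameShift K) := by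
    funext p
    simp only [hFg, hFa, Pi.add_apply, Pi.neg_apply, frameShift, evalM]
    rw [show (klLocSelfEnergyRe L M β U μ K n) = fun q => (klLocSelfEnergyRe L M β U μ K n q - K.eval (latticeMomentum L q)) +
      K.eval (latticeMomentum L q) from funext fun q => by ring]
    rw [eval_symInterp_add]
    ring
  have hGA : ∀ {k : WithTop ℕ∞}, ContDiff ℝ k (Fg + Fa) := fun {k} => hFgc.add hFac
  rw [← norm_iteratedFDeriv_one, hsplit,
    iteratedFDeriv_add_apply (hGA.contDiffAt.of_le le_top) (hKc.contDiffAt.of_le le_top),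
    iteratedFDeriv_add_apply (hFgc.contDiffAt.of_le le_top) (hFac.contDiffAt.of_le le_top), iteratedFDeriv_neg_apply]
  refine (norm_add_le _ _).trans (add_le_add ((norm_add_le _ _).trans (add_le_add (hm q) (ha q))) ?_)
  rw [norm_neg]

end Summit.HubbardSuperconductivity.HubbardSuperconductivity.Theorems.KLRegimeSplit

end
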